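import Mathlib
import Literature.MathematicalPhysics.QuantumLattice.HubbardModel
import HarnessLib

/-!
# Route `JosephsonMirror` — co-countable selection of the coupling (crux `JmCusp`)

Helper file (`--supports` stmt-HubbardSuperconductivity-2228, crux `JmCusp`, line
`cocountable-coupling-selection`) for route `JosephsonMirror` (sub-problem `HubbardSuperconductivity`):
the registered stub `stub_cocountableSelection`.

At a fixed even side length `L` let `Bad_L ⊆ (a, b)` be the set of couplings `U` at which the
`(N_L, S^z = 0)` ground floor of `hubbardTorus 2 L 1 U` is NOT simple (two ground states need not be
proportional).  If `Bad_L` is finite for every large even `L`, then `⋃_L Bad_L` is countable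
(`Set.countable_iUnion`, `Set.Finite.countable`), whereas the open interval `Set.Ioo a b` (`a < b`) is
uncountable (`Cardinal.mk_Ioo_real`, `Cardinal.aleph0_lt_continuum`); hence some coupling of the window
lies in no `Bad_L`, i.e. its floor is simple at EVERY large even `L` at once.  The physics predicate is
treated as an opaque `P : ℕ → ℝ → Prop` (`exists_mem_Ioo_forall_of_finite`); the stub is its
specialisation.

Pure set theory (Cantor: a real interval is uncountable); folklore; no new definitions.
-/

-- the mandated namespace `Summit.<Summit>.<Problem>.Theorems` repeats `HubbardSuperconductivity`
-- (single-problem summit), which the `dupNamespace` linter flags on every declaration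
set_option linter.dupNamespace false

namespace Summit.HubbardSuperconductivity.HubbardSuperconductivity.Theorems.JosephsonMirror

open Literature.MathematicalPhysics.QuantumLattice

/-! ### Abstract co-countable selection -/

/-- A non-degenerate real open interval is uncountable (it has the cardinality of the continuum,
`Cardinal.mk_Ioo_real`). [folklore] -/
theorem not_countable_Ioo {a b : ℝ} (hab : a < b) : ¬ (Set.Ioo a b).Countable := by
  intro hc
  rw [← Cardinal.le_aleph0_iff_set_countable, Cardinal.mk_Ioo_real hab] at hc
  exact hc.not_gt Cardinal.aleph0_lt_continuum

/-- **Co-countable selection.**  If for every `L ≥ L₁` with `L ≠ 0`, `Even L` the exceptional set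
`{U ∈ (a, b) | ¬ P L U}` is finite, then some `U ∈ (a, b)` satisfies `P L U` for all such `L` at once:
the union of the exceptional sets is countable, the interval is not. [folklore] -/
theorem exists_mem_Ioo_forall_of_finite {a b : ℝ} (hab : a < b) (L₁ : ℕ) {P : ℕ → ℝ → Prop}
    (hfin : ∀ (L : ℕ) [NeZero L], Even L → L₁ ≤ L →
      Set.Finite {U : ℝ | U ∈ Set.Ioo a b ∧ ¬ P L U}) :
    ∃ U ∈ Set.Ioo a b, ∀ (L : ℕ) [NeZero L], Even L → L₁ ≤ L → P L U := by
  classical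
  -- the bad set: a countable union of finite sets
  set B : Set ℝ := ⋃ (L : ℕ) (_ : L ≠ 0 ∧ Even L ∧ L₁ ≤ L),
    {U : ℝ | U ∈ Set.Ioo a b ∧ ¬ P L U} with hB
  have hBc : B.Countable :=
    Set.countable_iUnion fun L => Set.countable_iUnion fun h =>
      (@hfin L ⟨h.1⟩ h.2.1 h.2.2).countable
  -- the interval is uncountable, so it is not contained in `B`
  obtain ⟨U, hU, hUB⟩ : ∃ U ∈ Set.Ioo a b, U ∉ B := by
    by_contra h
    push Not at h
    exact not_countable_Ioo hab (hBc.mono fun U hU => h U hU)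
  refine ⟨U, hU, fun L _ hE hL => ?_⟩
  by_contra hP
  exact hUB (Set.mem_iUnion₂.2 ⟨L, ⟨NeZero.ne L, hE, hL⟩, hU, hP⟩)

/-! ### The registered stub -/

/-- `stub_cocountableSelection` — CO-COUNTABLE SELECTION OF THE COUPLING: if for every large even `L`
only finitely many couplings of the window `(a, b)` have a degenerate `(N_L, S^z = 0)` ground floor of
`hubbardTorus 2 L 1 U` (`N_L = 2⌊(1 - δ)L²/2⌋`), then some coupling of the window has a simple floor at
EVERY large even `L` (`exists_mem_Ioo_forall_of_finite`: a countable union of finite sets does not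
exhaust an uncountable interval). [folklore] -/
theorem stub_cocountableSelection :
    ∀ (δ a b : ℝ) (L₁ : ℕ), a < b →
      (∀ (L : ℕ) [NeZero L], Even L → L₁ ≤ L → Set.Finite {U : ℝ | U ∈ Set.Ioo a b ∧ ¬ ∀ φ φ' : Literature.MathematicalPhysics.QuantumLattice.Fock (Literature.MathematicalPhysics.QuantumLattice.Orb (Literature.MathematicalPhysics.QuantumLattice.FermionTorus 2 L)), Literature.MathematicalPhysics.QuantumLattice.IsGroundStateInSector (Literature.MathematicalPhysics.QuantumLattice.hubbardTorus 2 L 1 U) (2 * ⌊(1 - δ) * (L : ℝ) ^ 2 / 2⌋₊) 0 φ → Literature.MathematicalPhysics.QuantumLattice.IsGroundStateInSector (Literature.MathematicalPhysics.QuantumLattice.hubbardTorus 2 L 1 U) (2 * ⌊(1 - δ) * (L : ℝ) ^ 2 / 2⌋₊) 0 φ' → ∃ c : ℂ, φ' = c • φ}) →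
      ∃ U ∈ Set.Ioo a b, ∀ (L : ℕ) [NeZero L], Even L → L₁ ≤ L → ∀ φ φ' : Literature.MathematicalPhysics.QuantumLattice.Fock (Literature.MathematicalPhysics.QuantumLattice.Orb (Literature.MathematicalPhysics.QuantumLattice.FermionTorus 2 L)), Literature.MathematicalPhysics.QuantumLattice.IsGroundStateInSector (Literature.MathematicalPhysics.QuantumLattice.hubbardTorus 2 L 1 U) (2 * ⌊(1 - δ) * (L : ℝ) ^ 2 / 2⌋₊) 0 φ → Literature.MathematicalPhysics.QuantumLattice.IsGroundStateInSector (Literature.MathematicalPhysics.QuantumLattice.hubbardTorus 2 L 1 U) (2 * ⌊(1 - δ) * (L : ℝ) ^ 2 / 2⌋₊) 0 φ' → ∃ c : ℂ, φ' = c • φ := by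
  intro δ a b L₁ hab hfin
  exact exists_mem_Ioo_forall_of_finite hab L₁
    (P := fun (L : ℕ) (U : ℝ) => ∀ φ φ' : Fock (Orb (FermionTorus 2 L)),
      IsGroundStateInSector (hubbardTorus 2 L 1 U) (2 * ⌊(1 - δ) * (L : ℝ) ^ 2 / 2⌋₊) 0 φ →
      IsGroundStateInSector (hubbardTorus 2 L 1 U) (2 * ⌊(1 - δ) * (L : ℝ) ^ 2 / 2⌋₊) 0 φ' →
      ∃ c : ℂ, φ' = c • φ) hfin

end Summit.HubbardSuperconductivity.HubbardSuperconductivity.Theorems.JosephsonMirror
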